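import Literature.Geometry.Riemannian.ChangGurskyYangProofs
import Literature.Geometry.Riemannian.HamiltonCurvatureODE
import Literature.Geometry.Riemannian.EinsteinWeylZero
import Literature.Geometry.Riemannian.ConstantCurvature
import Literature.Geometry.Riemannian.RiemannianDistance
import Summits.SmoothPoincare4.SmoothPoincare4.Theses.EntropyRung

/-!
# Sketch (crux-ideate, ideator 3) — first lemmas of three lines for crux
`EntropyRung.ChangGurskyYang` (stmt-SmoothPoincare4-10834)

Card A `margerin-certified-cone`  : Margerin's weak-pinching sublevel sets are forward-invariant
  under Hamilton's block ODE (the algebraic heart of Margerin 1998, Parts II–V), typed over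
  `HamiltonODE.field` / `HamiltonODE.IsInvariant` of `HamiltonCurvatureODE.lean`.
Card B `gv-weyl-shifted-path`     : the starting point and the target of the Gursky–Viaclovsky
  one-parameter path for the Weyl-shifted `σ₂` equation (replaces CGY Thm 1.4's proof).
Card C `noncollapsed-round-limit` : the endgame "trace-free curvature ≡ 0, `R(x₀) > 0`, complete ⇒
  constant positive curvature" (Schur + Einstein–Weyl-zero), replacing Hamilton 1982 §§10–17.
-/

noncomputable section

open scoped Manifold ContDiff ENNReal Matrix
open Set

namespace Summit.SmoothPoincare4.SmoothPoincare4.Cruxes.ChangGurskyYang.Sketch3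

open Literature.Geometry.Riemannian
open Literature.Geometry.Lorentzian (PseudoRiemannianMetric riemannianMeasure)
open Literature.Geometry.Lorentzian.PseudoRiemannianMetric

/-! ## Card A — Margerin's cone in Hamilton's blocks -/

/-- Frobenius square norm of a `3 × 3` matrix. -/
def frob (M : Matrix (Fin 3) (Fin 3) ℝ) : ℝ := ∑ i, ∑ j, (M i j) ^ 2

/-- Frobenius pairing. -/
def frobInner (M N : Matrix (Fin 3) (Fin 3) ℝ) : ℝ := ∑ i, ∑ j, M i j * N i j

/-- Trace-free part of a `3 × 3` matrix. -/
def tf (M : Matrix (Fin 3) (Fin 3) ℝ) : Matrix (Fin 3) (Fin 3) ℝ := M - (M.trace / 3) • (1 : Matrix (Fin 3) (Fin 3) ℝ)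

/-- `|W|² + 2|E|²` in blocks `(A, B, C)` of the curvature operator (either Hamilton normalisation:
the quotient below is scale-free): `|W|²_{(0,4)} ∝ ‖Å‖² + ‖C̊‖²`, `2|E|² ∝ 2‖B‖²`
(`weylNormSqFrame_eq_hamiltonBlocks`; Hamilton 1997 §1.2: `B` ↔ trace-free Ricci). -/
def wpNum (p : HamiltonODE.Blocks) : ℝ := frob (tf p.1) + frob (tf p.2.2) + 2 * frob p.2.1

/-- Scalar curvature in blocks: `R ∝ tr A + tr C`. -/
def scalB (p : HamiltonODE.Blocks) : ℝ := p.1.trace + p.2.2.trace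

/-- Margerin's weak pinching of a block triple, `WP = (|W|² + 2|E|²)/R²` (CGY 2003 (0.2)). -/
def wpB (p : HamiltonODE.Blocks) : ℝ := wpNum p / scalB p ^ 2

/-- The closed convex `O(4)`-invariant cone `{R ≥ 0, |Z| ≤ √c · R}` = `{WP ≤ c}` (a second-order
cone: convex), symmetric under `B ↦ -B`. -/
def margerinCone (c : ℝ) : Set HamiltonODE.Blocks :=
  {p | 0 ≤ scalB p ∧ wpNum p ≤ c * scalB p ^ 2}

/-- Directional derivative of `wpNum` at `p` in direction `q` (a polynomial; no calculus needed:
`d/dt ‖tf(A + tX)‖² = 2⟨tf A, tf X⟩`, `d/dt ‖B + tY‖² = 2⟨B, Y⟩`). -/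
def dWpNum (p q : HamiltonODE.Blocks) : ℝ :=
  2 * frobInner (tf p.1) (tf q.1) + 2 * frobInner (tf p.2.2) (tf q.2.2) + 4 * frobInner p.2.1 q.2.1

/-- **First lemma (A), differential form = the certificate target.** Margerin's fundamental
polynomial is non-positive on `1/6`-weakly pinched curvature operators: along Hamilton's ODE
`(A,B,C)' = field (A,B,C)`, `d/dt WP ≤ 0` wherever `R > 0` and `WP ≤ 1/6`, i.e.
`(wpNum)' · R² - wpNum · (R²)' ≤ 0` (Margerin 1998, Prop. 4 / Parts II–V: "Q₂(R) is non-positive on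
1/6-weakly pinched curvature tensors, and negative on any more pinched curvature"). A quartic
polynomial inequality in the 27 block entries on a basic semialgebraic set — to be discharged by a
machine-found Positivstellensatz certificate checked in Lean. -/
def MargerinPolynomialNonpos : Prop :=
  ∀ p : HamiltonODE.Blocks, 0 < scalB p → wpNum p ≤ (1 / 6 : ℝ) * scalB p ^ 2 →
    dWpNum p (HamiltonODE.field p) * scalB p ^ 2
      - wpNum p * (2 * scalB p * scalB (HamiltonODE.field p)) ≤ 0

/-- Strict form away from the round point and strictly inside the cone (Margerin's Lemma 9
hypothesis): `d/dt WP < 0` if `0 < WP < 1/6`. -/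
def MargerinPolynomialNeg : Prop :=
  ∀ p : HamiltonODE.Blocks, 0 < scalB p → 0 < wpNum p → wpNum p < (1 / 6 : ℝ) * scalB p ^ 2 →
    dWpNum p (HamiltonODE.field p) * scalB p ^ 2
      - wpNum p * (2 * scalB p * scalB (HamiltonODE.field p)) < 0

/-- **First lemma (A), invariance form** (what `hamilton_maximumPrinciple_curvatureODE` consumes):
every sublevel set `{WP ≤ c}`, `0 < c ≤ 1/6`, is forward-invariant under Hamilton's ODE. -/
def MargerinConeInvariant : Prop :=
  ∀ c : ℝ, 0 < c → c ≤ 1 / 6 →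
    HamiltonODE.IsInvariant HamiltonODE.field (fun _ ↦ margerinCone c)

/-- Sanity instance of the statement at the `S³ × ℝ` shape `(½I, ½I, ½I)`: it lies on the boundary
`WP = 1/6` and is a fixed shape of the ODE (`field = (I, I, I) = 2 •` itself), so the derivative
vanishes there — the inequality is SHARP (checked by `norm_num` below on the two scalars). -/
example : wpNum ((1/2 : ℝ) • (1 : Matrix (Fin 3) (Fin 3) ℝ), (1/2 : ℝ) • (1 : Matrix (Fin 3) (Fin 3) ℝ),
    (1/2 : ℝ) • (1 : Matrix (Fin 3) (Fin 3) ℝ)) = 3 / 2 ∧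
    scalB ((1/2 : ℝ) • (1 : Matrix (Fin 3) (Fin 3) ℝ), (1/2 : ℝ) • (1 : Matrix (Fin 3) (Fin 3) ℝ),
    (1/2 : ℝ) • (1 : Matrix (Fin 3) (Fin 3) ℝ)) = 3 := by
  constructor
  · simp [wpNum, frob, tf, Matrix.trace, Fin.sum_univ_three, Matrix.smul_apply, Matrix.one_apply,
      Matrix.sub_apply]
    norm_num
  · simp [scalB, Matrix.trace, Fin.sum_univ_three, Matrix.smul_apply, Matrix.one_apply]
    norm_num

/-! ## Card B — the Gursky–Viaclovsky path for the Weyl-shifted `σ₂` equation -/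

section CardB

variable {M : Type} [TopologicalSpace M] [T2Space M] [SecondCountableTopology M]
  [ChartedSpace (EuclideanSpace ℝ (Fin 4)) M] [IsManifold (𝓡 4) ∞ M] [CompactSpace M]

/-- **First lemma (B): the path has an admissible starting point.** On a closed `4`-manifold with
`R > 0`, for `δ` negative enough the Weyl-shifted `t`-Schouten functional is pointwise positive at
`t = δ` and `u ≡ 0`:  `¼|W|² < σ₂(A) + (1/6)(1-δ)(2-δ) R²`, i.e. `4σ₂(A^δ_GV) - ¼|W|² > 0`
(Gursky–Viaclovsky 2003, §3 first paragraph: "Since `R_g > 0` there exists `δ > -∞` so that `A^δ_g`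
is positive definite", with their Lemma `σ₂(A^t) = σ₂(A¹) + (3/2)(1-t)(2-t)σ₁(A¹)²`, `σ₁(A¹) = R/6`,
`4σ₂(A¹) = σ₂(A_CGY)`). Provable now: continuity of `|W|²`, `σ₂(A)`, `R` (tree) + compactness. -/
def ShiftedPathStart
    (g : PseudoRiemannianMetric (𝓡 4) ∞ (EuclideanSpace ℝ (Fin 4)) (TangentSpace (𝓡 4) : M → Type _))
    [g.HasLeviCivita] : Prop :=
  g.IsRiemannian → (∀ x, 0 < g.scalarCurvature x) →
    ∃ δ : ℝ, δ ≤ 1 ∧ ∀ x : M,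
      (1 / 4 : ℝ) * g.weylNormSq x <
        g.sigma2WeylSchouten x + (1 / 6 : ℝ) * (1 - δ) * (2 - δ) * g.scalarCurvature x ^ 2

/-- **Target of line B = `hThm14` in the crux's own hypotheses (R > 0 instead of Y > 0) and with
`R > 0` in the conclusion for free** (Gursky–Viaclovsky 2003, Thm. 1 at `t₀ = 1`, WITH the Weyl
shift `-¼|W|²` carried along the whole path; CGY 2003, Thm. 1.4, `α = 1`): if `R_{g₀} > 0` and
`¼∫|W|² < ∫σ₂(A)`, some conformal metric has `R > 0` and `σ₂(A) - ¼|W|² > 0` pointwise. -/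
def WeylShiftedGV : Prop :=
  ∀ (M : Type) [TopologicalSpace M] [T2Space M] [SecondCountableTopology M]
    [ChartedSpace (EuclideanSpace ℝ (Fin 4)) M] [IsManifold (𝓡 4) ∞ M] [CompactSpace M]
    [ConnectedSpace M] [MeasurableSpace M] [BorelSpace M]
    (g₀ : PseudoRiemannianMetric (𝓡 4) ∞ (EuclideanSpace ℝ (Fin 4)) (TangentSpace (𝓡 4) : M → Type _))
    [g₀.HasLeviCivita] (hg₀ : g₀.IsRiemannian),
    (∀ x, 0 < g₀.scalarCurvature x) →
    1 / 4 * g₀.weylEnergy.toReal < g₀.sigma2WeylSchoutenIntegral →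
    ∃ (g : PseudoRiemannianMetric (𝓡 4) ∞ (EuclideanSpace ℝ (Fin 4)) (TangentSpace (𝓡 4) : M → Type _))
      (_ : g.HasLeviCivita) (hg : g.IsRiemannian),
      IsConformalTo (g.toContMDiffRiemannianMetric hg) (g₀.toContMDiffRiemannianMetric hg₀) ∧
      (∀ x, 0 < g.scalarCurvature x) ∧ ∀ x, 1 / 4 * g.weylNormSq x < g.sigma2WeylSchouten x

end CardB

/-! ## Card C — the non-collapsed blow-up endgame -/

/-- **First lemma (C).** A connected complete Riemannian `4`-manifold whose trace-free curvature
vanishes identically (`|W|² = 0` and `|E|² = 0`, i.e. Margerin's `Z ≡ 0` — the shape every blow-up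
limit has once `|Z|² ≤ K R^β`, `β < 2`) and which is non-flat at one point has constant POSITIVE
sectional curvature and is compact (Schur's lemma, `EinsteinWeylZero.lean`, Bonnet–Myers — all but
Schur already in the tree). -/
def RoundLimit : Prop :=
  ∀ (M : Type) [TopologicalSpace M] [T2Space M] [SecondCountableTopology M]
    [ChartedSpace (EuclideanSpace ℝ (Fin 4)) M] [IsManifold (𝓡 4) ∞ M] [ConnectedSpace M]
    (g : PseudoRiemannianMetric (𝓡 4) ∞ (EuclideanSpace ℝ (Fin 4)) (TangentSpace (𝓡 4) : M → Type _))
    [g.HasLeviCivita] (hg : g.IsRiemannian),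
    (∀ (x : M) (r : NNReal), IsCompact {y : M | g.edist hg x y ≤ r}) →
    (∀ x, g.weylNormSq x = 0 ∧ g.tracelessRicciNormSq x = 0) →
    (∃ x₀, 0 < g.scalarCurvature x₀) →
    CompactSpace M ∧ ∃ c : ℝ, 0 < c ∧ g.HasConstantSectionalCurvature c

/-! ## The crux these lines conclude (by name) -/

example : Summit.SmoothPoincare4.SmoothPoincare4.Theses.EntropyRung.ChangGurskyYang ↔
    changGurskyYang_sphere_four := Iff.rfl

end Summit.SmoothPoincare4.SmoothPoincare4.Cruxes.ChangGurskyYang.Sketch3
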